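import Literature.Analysis.FluidPDE.TaoAveragedComplexAverageReal
import Literature.Analysis.FluidPDE.TaoCascadeDuhamel

/-!
# Route PerpetualPump · `EulerTypeIGlue` — stub `stub_normalise` (line `Sketch`)

Viscosity normalisation on Tao's side. Suppose a curve `U : [0,T) → H¹⁰_df(ℝ³)` (continuous in
`H¹⁰`) obeys Tao's mild identity (2016, (1.15)) **at viscosity `ν > 0`**,
`⟨U t, w⟩ = ⟨e^{νtΔ} U 0, w⟩ + ∫₀ᵗ ⟨B(U s, U s), e^{ν(t-s)Δ} w⟩ ds` for all `w ∈ H¹⁰_df`, with datum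
`U 0 = [u₀^ℂ]` (`schwartzL2 u₀`) and the `L^∞` rate `‖U t‖_∞ ≤ M/√(T-t)`. Then the time-rescaled
curve `W s = ν⁻¹ • U (s/ν)` is a mild `H¹⁰_df` solution, in the unit-viscosity sense of
`IsMildSolutionFor`, of the Euler-datum equation `∂ₜW = ΔW + B(W,W)` (`AveragingDatum.euler`,
whose form is the Euler trilinear form, `AveragingDatum.euler_form`) on `[0, νT)` from
`[(ν⁻¹u₀)^ℂ]`, and obeys the rate `‖W s‖_∞ ≤ (ν⁻¹ M √ν)/√(νT - s)`.

The proof is pure algebra: `H¹⁰_df` is a real subspace (`MemH10df.smul`), `‖c x‖_{H^s} =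
|c| ‖x‖_{H^s}` (`eFourierSobolevNorm_const_smul`, from `fourierFn_smul` and
`sobolevWeightIntegral_smul`), the pairing and `B` are (tri)linear (`pairing_smul_left`,
`eulerForm_smul₁`, `eulerForm_symm`), `e^{τΔ}` is linear (`fourierMultiplier_smul`), the datum
scales (`schwartzL2_smul`), and the substitution `τ = σ/ν` in the Duhamel integral is
`intervalIntegral.integral_comp_div`; the coefficient identity is `ν⁻² · ν = ν⁻¹`.

## References

* T. Tao, J. Amer. Math. Soc. 29 (2016), arXiv:1402.0290v3, §1.1 (1.5), (1.15), and p. 6 (the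
  Euler bilinear operator is its own average). [Tao2016AveragedNS]
-/

noncomputable section

open MeasureTheory Set Filter Topology FourierTransform
open scoped ENNReal NNReal RealInnerProductSpace SchwartzMap ContDiff

set_option linter.dupNamespace false

namespace Summit.NavierStokesRegularity.NavierStokesRegularity.Theorems.PerpetualPumpEulerTypeIGlue

open Literature.Analysis.FluidPDE Literature.Analysis.FluidPDE.Tao2016
open Literature.Analysis.FunctionSpaces (eFourierSobolevNorm)
open Literature.Analysis.FunctionSpaces.EuclideanSpace (complexify complexify_apply norm_complexify
  continuous_complexify)

/-- Local notation for physical / frequency space `ℝ³`. -/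
local notation "ℝ³" => EuclideanSpace ℝ (Fin 3)
/-- Local notation for the complexified range `ℂ³`. -/
local notation "ℂ³" => EuclideanSpace ℂ (Fin 3)

/-! ### Linear bookkeeping on `L²(ℝ³; ℂ³)` -/

/-- The heat propagator `e^{τΔ}` commutes with complex scalars (it is a Fourier multiplier).
[folklore] -/
theorem heat_const_smul (τ : ℝ) (a : ℂ) (u : L2C) : heat τ (a • u) = a • heat τ u := by
  unfold heat
  rw [fourierMultiplier_smul]

/-- `‖a u‖_{H^s} = |a| ‖u‖_{H^s}` for the Fourier-side Sobolev norm. [folklore] -/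
theorem eFourierSobolevNorm_const_smul (s : ℝ) (a : ℂ) (u : L2C) :
    eFourierSobolevNorm s (a • u) = ‖a‖ₑ * eFourierSobolevNorm s u := by
  rw [eFourierSobolevNorm_eq, eFourierSobolevNorm_eq,
    sobolevWeightIntegral_congr_ae (fourierFn_smul a u), sobolevWeightIntegral_smul,
    ENNReal.mul_rpow_of_nonneg _ _ (by norm_num : (0 : ℝ) ≤ 1 / 2)]
  congr 1
  rw [← ENNReal.rpow_natCast, ← ENNReal.rpow_mul]
  norm_num

/-- `‖a u‖_{L^p} = |a| ‖u‖_{L^p}` for the representative of a scaled `L²` class. [folklore] -/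
theorem eLpNorm_coe_const_smul (a : ℂ) (u : L2C) (p : ℝ≥0∞) :
    eLpNorm ((a • u : L2C) : ℝ³ → ℂ³) p volume = ‖a‖ₑ * eLpNorm (u : ℝ³ → ℂ³) p volume := by
  rw [eLpNorm_congr_ae (Lp.coeFn_smul a u), eLpNorm_const_smul]

/-- The Euler quadratic form scales quadratically: `⟨B(ax, ax), z⟩ = a² ⟨B(x,x), z⟩` (no
convergence needed). [cite: Tao2016AveragedNS, §1.1 (1.3)] -/
theorem eulerForm_smul_smul (a : ℂ) (x z : L2C) :
    eulerForm (a • x) (a • x) z = a ^ 2 * eulerForm x x z := by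
  rw [eulerForm_smul₁, eulerForm_symm x (a • x) z, eulerForm_smul₁]
  ring

/-! ### Elementary real arithmetic of the time rescaling `s = ν t` -/

/-- `s ∈ [0, νT)` iff `s/ν ∈ [0, T)` (the direction used). [folklore] -/
theorem div_mem_Ico_of_mem_Ico_mul {ν T s : ℝ} (hν : 0 < ν) (hs : s ∈ Ico 0 (ν * T)) :
    s / ν ∈ Ico 0 T :=
  ⟨div_nonneg hs.1 hν.le, (div_lt_iff₀ hν).2 (by rw [mul_comm]; exact hs.2)⟩

/-- The rescaled Type-I rate: `ν⁻¹ · M/√(T - s/ν) = (ν⁻¹ M √ν)/√(νT - s)`. [folklore] -/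
theorem inv_mul_rate_eq {ν T s : ℝ} (hν : 0 < ν) (M : ℝ) :
    ν⁻¹ * (M / Real.sqrt (T - s / ν)) = ν⁻¹ * M * Real.sqrt ν / Real.sqrt (ν * T - s) := by
  have h1 : T - s / ν = (ν * T - s) / ν := by
    field_simp
  rw [h1, Real.sqrt_div' _ hν.le, div_div_eq_mul_div]
  ring

/-! ### The stub -/

/-- **S6 — viscosity normalisation on Tao's side**: if `U` solves Tao's mild identity at viscosity `ν` on
`[0,T)` with datum `schwartzL2 u₀` and obeys the `L^∞` rate `M/√(T-t)`, then the time-rescaled curve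
`W s = ν⁻¹ • U (s/ν)` is an `H¹⁰_df`-mild solution of the (unit-viscosity) Euler-datum equation on `[0, νT)`
from `schwartzL2 (ν⁻¹ • u₀)`, with the rate `ν^{-1/2} M/√(νT - s)` (trilinearity of `B`, linearity of
`e^{τΔ}`, the substitution `τ = σ/ν`; `AveragingDatum.euler_form`). [cite: Tao2016AveragedNS, §1.1 (1.15) and p. 6 (euler datum)] -/
theorem stub_normalise {ν T : ℝ} (hν : 0 < ν) (u₀ : 𝓢(ℝ³, ℝ³)) (U : ℝ → L2C)
    (hU0 : U 0 = schwartzL2 u₀)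
    (hH : ∀ t ∈ Ico 0 T, MemH10df (U t)) (hc : ContinuousInH10On (Ico 0 T) U)
    (hid : ∀ t ∈ Ico 0 T, ∀ w, MemH10df w →
      pairing (U t) w = pairing (heat (ν * t) (U 0)) w +
        ∫ s in (0:ℝ)..t, eulerForm (U s) (U s) (heat (ν * (t - s)) w))
    (hrate : ∃ M : ℝ, ∀ t ∈ Ico 0 T, eLpNorm (U t) ⊤ volume ≤ ENNReal.ofReal (M / Real.sqrt (T - t))) :
    AveragingDatum.euler.IsMildSolution (schwartzL2 ((ν⁻¹ : ℝ) • u₀)) (Ico 0 (ν * T))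
        (fun s => ((ν⁻¹ : ℝ) : ℂ) • U (s / ν)) ∧
      ∃ M : ℝ, ∀ s ∈ Ico 0 (ν * T),
        eLpNorm ((((ν⁻¹ : ℝ) : ℂ) • U (s / ν) : L2C)) ⊤ volume ≤
          ENNReal.ofReal (M / Real.sqrt (ν * T - s)) := by
  have hν0 : ν ≠ 0 := hν.ne'
  -- the time rescaling maps `[0, νT)` into `[0, T)`
  have hmem : ∀ s ∈ Ico 0 (ν * T), s / ν ∈ Ico 0 T := fun s hs =>
    div_mem_Ico_of_mem_Ico_mul hν hs
  refine ⟨⟨fun s hs => (hH _ (hmem s hs)).smul ν⁻¹, ?_, fun s hs w hw => ?_⟩, ?_⟩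
  · -- (b) continuity in `H¹⁰` on `[0, νT)`
    intro s₀ hs₀
    show Tendsto (fun s => eFourierSobolevNorm 10
        (((ν⁻¹ : ℝ) : ℂ) • U (s / ν) - ((ν⁻¹ : ℝ) : ℂ) • U (s₀ / ν))) (𝓝[Ico 0 (ν * T)] s₀) (𝓝 0)
    have hg : Tendsto (fun s : ℝ => s / ν) (𝓝[Ico 0 (ν * T)] s₀) (𝓝[Ico 0 T] (s₀ / ν)) :=
      (continuous_id.div_const ν).continuousWithinAt.tendsto_nhdsWithin fun s hs => hmem s hs
    have h := (hc (s₀ / ν) (hmem s₀ hs₀)).comp hg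
    have h2 : Tendsto (fun s => ‖((ν⁻¹ : ℝ) : ℂ)‖ₑ *
        eFourierSobolevNorm 10 (U (s / ν) - U (s₀ / ν))) (𝓝[Ico 0 (ν * T)] s₀)
        (𝓝 (‖((ν⁻¹ : ℝ) : ℂ)‖ₑ * 0)) :=
      ENNReal.Tendsto.const_mul h (Or.inr enorm_ne_top)
    rw [mul_zero] at h2
    refine h2.congr fun s => ?_
    rw [← smul_sub, eFourierSobolevNorm_const_smul]
  · -- (c) the mild identity at unit viscosity, from `hid` at time `s/ν`
    show pairing (((ν⁻¹ : ℝ) : ℂ) • U (s / ν)) w =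
      pairing (heat s (schwartzL2 ((ν⁻¹ : ℝ) • u₀))) w +
        ∫ σ in (0:ℝ)..s, AveragingDatum.euler.form (((ν⁻¹ : ℝ) : ℂ) • U (σ / ν))
          (((ν⁻¹ : ℝ) : ℂ) • U (σ / ν)) (heat (s - σ) w)
    have key := hid (s / ν) (hmem s hs) w hw
    rw [mul_div_cancel₀ s hν0] at key
    obtain ⟨F, hF⟩ : ∃ F : ℝ → ℂ,
        F = fun τ => eulerForm (U τ) (U τ) (heat (ν * (s / ν - τ)) w) := ⟨_, rfl⟩
    rw [← hF] at key
    -- the integrand of the goal is `ν⁻² F(σ/ν)`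
    have h1 : ∀ σ : ℝ, AveragingDatum.euler.form (((ν⁻¹ : ℝ) : ℂ) • U (σ / ν))
        (((ν⁻¹ : ℝ) : ℂ) • U (σ / ν)) (heat (s - σ) w) = ((ν⁻¹ : ℝ) : ℂ) ^ 2 * F (σ / ν) := by
      intro σ
      have hσ : ν * (s / ν - σ / ν) = s - σ := by
        rw [mul_sub, mul_div_cancel₀ s hν0, mul_div_cancel₀ σ hν0]
      rw [hF]
      dsimp only
      rw [hσ, AveragingDatum.euler_form, eulerForm_smul_smul]
    have h2 : (∫ σ in (0:ℝ)..s, AveragingDatum.euler.form (((ν⁻¹ : ℝ) : ℂ) • U (σ / ν))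
        (((ν⁻¹ : ℝ) : ℂ) • U (σ / ν)) (heat (s - σ) w)) =
        ∫ σ in (0:ℝ)..s, ((ν⁻¹ : ℝ) : ℂ) ^ 2 * F (σ / ν) :=
      intervalIntegral.integral_congr fun σ _ => h1 σ
    have hcoef : ((ν⁻¹ : ℝ) : ℂ) ^ 2 * (ν : ℂ) = ((ν⁻¹ : ℝ) : ℂ) := by
      have hνC : (ν : ℂ) ≠ 0 := Complex.ofReal_ne_zero.2 hν0
      rw [Complex.ofReal_inv]
      field_simp
    have h3 : (∫ σ in (0:ℝ)..s, ((ν⁻¹ : ℝ) : ℂ) ^ 2 * F (σ / ν)) =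
        ((ν⁻¹ : ℝ) : ℂ) * ∫ τ in (0:ℝ)..(s / ν), F τ := by
      rw [intervalIntegral.integral_const_mul, intervalIntegral.integral_comp_div F hν0, zero_div,
        Complex.real_smul, ← mul_assoc, hcoef]
    rw [h2, h3, schwartzL2_smul, ← hU0, heat_const_smul, pairing_smul_left, pairing_smul_left, key]
    ring
  · -- (d) the rescaled `L^∞` rate
    obtain ⟨M, hM⟩ := hrate
    have hcn : ‖((ν⁻¹ : ℝ) : ℂ)‖ₑ = ENNReal.ofReal ν⁻¹ := by
      rw [← ofReal_norm, Complex.norm_real, Real.norm_eq_abs, abs_of_nonneg (inv_nonneg.2 hν.le)]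
    refine ⟨ν⁻¹ * M * Real.sqrt ν, fun s hs => ?_⟩
    rw [eLpNorm_coe_const_smul, hcn]
    calc ENNReal.ofReal ν⁻¹ * eLpNorm (U (s / ν) : ℝ³ → ℂ³) ⊤ volume
        ≤ ENNReal.ofReal ν⁻¹ * ENNReal.ofReal (M / Real.sqrt (T - s / ν)) :=
          mul_le_mul_right (hM _ (hmem s hs)) _
      _ = ENNReal.ofReal (ν⁻¹ * M * Real.sqrt ν / Real.sqrt (ν * T - s)) := by
          rw [← ENNReal.ofReal_mul (inv_nonneg.2 hν.le), inv_mul_rate_eq hν M]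

end Summit.NavierStokesRegularity.NavierStokesRegularity.Theorems.PerpetualPumpEulerTypeIGlue

end
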